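import Summits.PneNP.PneNP.Theorems.SzkEntropyPeaWorstToAvgStubOrbitKitSubst
import Literature.Computability.Complexity.GaussRankFP
import Literature.Computability.Complexity.CoinCounting
import Mathlib.LinearAlgebra.Matrix.GeneralLinearGroup.Card
import HarnessLib

/-!
# Orbit kit for `orbit-pair-rsr`, IV: the truncated-rejection sampler of `GL_s(F₂)`

Helper file of the stub `stub_orbitKit` (crux `SzkEntropy.PeaWorstToAvg`, line `orbit-pair-rsr`).
From a coin string we read `t` candidate `s × s` matrices over `F₂` and keep the first invertible one
(rank `= s` by the list Gaussian elimination `GaussRank.lrank`), falling back to the identity: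

* `bz`, `readVec`, `readMat`, `idRows`, `inv`, `blocks`, `sel` and the recursion `sel_succ`;
* `inv_readMat_iff` — the rank test decides invertibility; `isUnit_matT_sel` — the output is invertible;
* counting: reading a matrix / a vector off a coin block is a bijection (`cnt_readMat_eq_one`,
  `cnt_readVec_eq_one`), `glCount` (number of invertible matrices), and **`selCount_bound`**:
  `#{u ∈ {0,1}^{t s²} | sel u = A} · glCount s + (2^{s²} - glCount s)^t ≥ 2^{t s²}` for invertible `A`,
  i.e. the law of `sel` is `(1 - σ^t) · U(GL_s) + σ^t · δ_1`, `σ` the density of singular matrices.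

References: folklore (rejection sampling of `GL_n(F_q)`); S. Arora, B. Barak, *Computational
Complexity*, CUP 2009, §7.1 (coin blocks); J. von zur Gathen, J. Gerhard, *Modern Computer Algebra*,
§12.1 (rank by Gaussian elimination).
-/

namespace Summit.PneNP.PneNP.Cruxes.PeaWorstToAvg.OrbitPairRsr

set_option linter.dupNamespace false -- Summit.PneNP.PneNP: summit = sub-problem (D-0017)

open Literature.Computability.Complexity Literature.Computability.MetaComplexity

namespace OKit

/-! ### Reading matrices off coin strings -/

/-- A coin as an element of `F₂`. [folklore] -/
def bz (b : Bool) : ZMod 2 := if b then 1 else 0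

/-- `bz` is injective. [folklore] -/
theorem bz_injective : Function.Injective bz := by
  intro a b h; cases a <;> cases b <;> simp_all [bz]

/-- The vector of the first `s` coins. [folklore] -/
def readVec (s : ℕ) (u : List Bool) : List (ZMod 2) := (List.range s).map fun j => bz (u.getD j false)

/-- The `s × s` matrix of the first `s²` coins, row `i` at offset `i s`. [folklore] -/
def readMat (s : ℕ) (u : List Bool) : List (List (ZMod 2)) :=
  (List.range s).map fun i => readVec s (u.drop (i * s))

/-- The rows of the identity matrix. [folklore] -/
def idRows (s : ℕ) : List (List (ZMod 2)) :=
  (List.range s).map fun i => (List.range s).map fun j => if i = j then 1 else 0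

/-- The invertibility test: rank `= s` by Gaussian elimination. [folklore] -/
def inv (s : ℕ) (R : List (List (ZMod 2))) : Bool := decide (GaussRank.lrank s R = s)

/-- The `t` candidate matrices read off consecutive blocks of `s²` coins. [folklore] -/
def blocks (s t : ℕ) (u : List Bool) : List (List (List (ZMod 2))) :=
  (List.range t).map fun i => readMat s ((u.drop (i * (s * s))).take (s * s))

/-- **Truncated rejection sampling of `GL_s(F₂)`**: the first invertible candidate, else the identity.
[folklore] -/
def sel (s t : ℕ) (u : List Bool) : List (List (ZMod 2)) := ((blocks s t u).find? (inv s)).getD (idRows s)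

/-- Items of a map over `range`. [folklore] -/
theorem getD_map_range {α : Type} (f : ℕ → α) {s i : ℕ} (hi : i < s) (d : α) :
    ((List.range s).map f).getD i d = f i := by
  rw [List.getD_eq_getElem _ _ (by simpa using hi)]; simp

/-- Entries of a read vector. [folklore] -/
theorem getD_readVec (s : ℕ) (u : List Bool) {j : ℕ} (hj : j < s) : (readVec s u).getD j 0 = bz (u.getD j false) :=
  getD_map_range _ hj _

/-- Length of a read vector. [folklore] -/
@[simp] theorem length_readVec (s : ℕ) (u : List Bool) : (readVec s u).length = s := by simp [readVec]

/-- Number of rows of a read matrix. [folklore] -/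
@[simp] theorem length_readMat (s : ℕ) (u : List Bool) : (readMat s u).length = s := by simp [readMat]

/-- Rows of a read matrix have length `s`. [folklore] -/
theorem length_of_mem_readMat {s : ℕ} {u : List Bool} {row : List (ZMod 2)} (h : row ∈ readMat s u) :
    row.length = s := by
  obtain ⟨i, -, rfl⟩ := List.mem_map.1 h; exact length_readVec _ _

/-- Entries of a read matrix: entry `(i, j)` is coin `i s + j`. [folklore] -/
theorem ent_readMat {s : ℕ} (u : List Bool) {i j : ℕ} (hi : i < s) (hj : j < s) :
    ent (readMat s u) i j = bz (u.getD (i * s + j) false) := by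
  rw [ent, readMat, getD_map_range _ hi, getD_readVec _ _ hj, List.getD_eq_getElem?_getD, List.getElem?_drop,
    ← List.getD_eq_getElem?_getD]

/-- The typed vector read off the coins. [folklore] -/
theorem vecT_readVec {s : ℕ} (u : List Bool) : vecT s (readVec s u) = fun i : Fin s => bz (u.getD i false) :=
  funext fun i => getD_readVec s u i.isLt

/-- The typed matrix read off the coins. [folklore] -/
theorem matT_readMat {s : ℕ} (u : List Bool) :
    matT s (readMat s u) = Matrix.of fun i j : Fin s => bz (u.getD (i * s + j) false) := by
  ext i j; exact ent_readMat u i.isLt j.isLt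

/-- The identity rows read as the identity matrix. [folklore] -/
theorem matT_idRows (s : ℕ) : matT s (idRows s) = 1 := by
  ext i j
  simp only [matT, Matrix.of_apply, ent, idRows]
  rw [getD_map_range _ i.isLt, getD_map_range _ j.isLt]
  simp [Matrix.one_apply, Fin.ext_iff]

/-! ### The recursion of the sampler -/

/-- Peeling the first candidate. [folklore] -/
theorem blocks_succ (s t : ℕ) (u : List Bool) :
    blocks s (t + 1) u = readMat s (u.take (s * s)) :: blocks s t (u.drop (s * s)) := by
  rw [blocks, List.range_succ_eq_map, List.map_cons, List.map_map, blocks]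
  simp only [Nat.zero_mul, List.drop_zero, List.cons.injEq, true_and]
  refine List.map_congr_left fun i _ => ?_
  simp only [Function.comp_apply, Nat.succ_eq_add_one, List.drop_drop]
  congr 2; ring

/-- No candidates: the identity. [folklore] -/
theorem sel_zero (s : ℕ) (u : List Bool) : sel s 0 u = idRows s := rfl

/-- **The rejection step**: keep the first candidate if invertible, else recurse on the remaining coins.
[folklore] -/
theorem sel_succ (s t : ℕ) (u : List Bool) :
    sel s (t + 1) u = if inv s (readMat s (u.take (s * s))) then readMat s (u.take (s * s))
      else sel s t (u.drop (s * s)) := by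
  rw [sel, blocks_succ, List.find?_cons]
  cases inv s (readMat s (u.take (s * s))) <;> rfl

/-! ### The rank test decides invertibility -/

/-- **The rank test is correct** on lists of `s` rows of length `s`: rank `= s` iff the matrix is
invertible. [cite: AroraBarak2009, §1.3] -/
theorem inv_iff {s : ℕ} {R : List (List (ZMod 2))} (hlen : R.length = s) (hrow : ∀ row ∈ R, row.length = s) :
    inv s R = true ↔ IsUnit (matT s R) := by
  rw [inv, decide_eq_true_iff, GaussRank.lrank_eq_finrank_span R hrow,
    ← Matrix.linearIndependent_rows_iff_isUnit, linearIndependent_iff_card_eq_finrank_span,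
    Fintype.card_fin, Set.finrank]
  have hrange : (Set.range fun (i : Fin R.length) (k : Fin s) => (R.getD i []).getD k 0) =
      Set.range (matT s R).row := by
    subst hlen
    rfl
  rw [hrange]
  exact eq_comm

/-- The rank test on a read matrix. [folklore] -/
theorem inv_readMat_iff {s : ℕ} (u : List Bool) : inv s (readMat s u) = true ↔ IsUnit (matT s (readMat s u)) :=
  inv_iff (length_readMat s u) fun _ h => length_of_mem_readMat h

/-- **The sampler outputs invertible matrices** (a passing candidate is invertible; the fallback is
the identity). [folklore] -/
theorem isUnit_matT_sel (s t : ℕ) (u : List Bool) : IsUnit (matT s (sel s t u)) := by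
  induction t generalizing u with
  | zero => rw [sel_zero, matT_idRows]; exact isUnit_one
  | succ t ih =>
    rw [sel_succ]
    split
    · exact (inv_readMat_iff _).1 ‹_›
    · exact ih _

/-- Candidates are well-formed read matrices, so `sel` is always a list of `s` rows of length `s`.
[folklore] -/
theorem sel_shape (s t : ℕ) (u : List Bool) :
    (sel s t u).length = s ∧ ∀ row ∈ sel s t u, row.length = s := by
  induction t generalizing u with
  | zero =>
    rw [sel_zero]
    refine ⟨by simp [idRows], fun row h => ?_⟩
    obtain ⟨i, -, rfl⟩ := List.mem_map.1 h; simp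
  | succ t ih =>
    rw [sel_succ]
    split
    · exact ⟨length_readMat _ _, fun _ h => length_of_mem_readMat h⟩
    · exact ih _

/-! ### Counting coin strings: products and fibres -/

/-- Coin strings of length `a + b` as pairs (first `a` coins, last `b` coins). [folklore] -/
def splitVec (a b : ℕ) : List.Vector Bool (a + b) ≃ List.Vector Bool a × List.Vector Bool b where
  -- adapted from Literature/Computability/Complexity/CompetitiveInteractiveProofsProofs.lean (splitVec)
  toFun w := (⟨w.toList.take a, by simp⟩, ⟨w.toList.drop a, by simp⟩)
  invFun p := p.1 ++ p.2
  left_inv w := List.Vector.eq _ _ (by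
    rw [List.Vector.toList_append]
    exact List.take_append_drop a w.toList)
  right_inv p := by
    obtain ⟨u, v⟩ := p
    have hu : u.toList.length = a := u.toList_length
    refine Prod.ext (List.Vector.eq _ _ ?_) (List.Vector.eq _ _ ?_)
    · show List.take a (u ++ v).toList = u.toList
      rw [List.Vector.toList_append, List.take_left' hu]
    · show List.drop a (u ++ v).toList = v.toList
      rw [List.Vector.toList_append, List.drop_left' hu]

/-- **Independent coin blocks multiply**: `#{w ∈ {0,1}^{a+b} | w↾a ∈ X ∧ w⇂a ∈ Y} = #X · #Y`.
[cite: AroraBarak2009, §7.1] -/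
theorem cnt_take_and_drop (a b : ℕ) (X Y : Set (List Bool)) :
    cnt (a + b) {w | w.take a ∈ X ∧ w.drop a ∈ Y} = cnt a X * cnt b Y := by
  classical
  unfold cnt
  rw [← Finset.card_product, ← Finset.filter_product]
  refine Finset.card_bij' (fun w _ => splitVec a b w) (fun p _ => (splitVec a b).symm p) ?_ ?_ ?_ ?_
  · intro w hw
    simpa [splitVec] using hw
  · intro p hp
    obtain ⟨u, v⟩ := p
    have h := (splitVec a b).apply_symm_apply (u, v)
    simp only [splitVec, Equiv.coe_fn_mk, Equiv.coe_fn_symm_mk, Prod.mk.injEq] at h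
    have h1 := congrArg List.Vector.toList h.1
    have h2 := congrArg List.Vector.toList h.2
    simp only [List.Vector.toList_mk] at h1 h2
    simp only [Finset.mem_filter, Finset.mem_univ, true_and, Set.mem_setOf_eq, Finset.mem_product] at hp ⊢
    simp only [splitVec, Equiv.coe_fn_symm_mk]
    rw [h1, h2]
    exact hp
  · intro w _; exact (splitVec a b).symm_apply_apply w
  · intro p _; exact (splitVec a b).apply_symm_apply p

/-- **A bijective read-out has singleton fibres**: if `r ↦ f r` is a bijection from `{0,1}^n`, exactly
one coin string of length `n` reads as `b`. [folklore] -/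
theorem cnt_fibre_eq_one {β : Type} (n : ℕ) (f : List Bool → β)
    (hf : Function.Bijective fun r : List.Vector Bool n => f r.toList) (b : β) : cnt n {u | f u = b} = 1 := by
  classical
  unfold cnt
  obtain ⟨r₀, hr₀, huniq⟩ := hf.existsUnique b
  rw [Finset.card_eq_one]
  refine ⟨r₀, Finset.eq_singleton_iff_unique_mem.2 ⟨by simpa using hr₀, fun r hr => huniq r ?_⟩⟩
  simpa using hr

/-- Reading a vector of `F₂ˢ` off `s` coins is a bijection. [folklore] -/
theorem readVec_bijective (s : ℕ) :
    Function.Bijective fun r : List.Vector Bool s => vecT s (readVec s r.toList) := by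
  classical
  refine (Fintype.bijective_iff_injective_and_card _).2 ⟨fun u v h => ?_, ?_⟩
  · simp only [vecT_readVec] at h
    refine List.Vector.eq _ _ (List.ext_getElem (by simp) fun i h₁ h₂ => ?_)
    have hi : i < s := by simpa using h₁
    have := bz_injective (congrFun h ⟨i, hi⟩)
    rwa [List.getD_eq_getElem _ _ h₁, List.getD_eq_getElem _ _ h₂] at this
  · rw [card_vector, Fintype.card_bool, Fintype.card_fun, ZMod.card, Fintype.card_fin]

/-- Exactly one block of `s` coins reads as a given vector. [folklore] -/
theorem cnt_readVec_eq_one (s : ℕ) (b : Fin s → ZMod 2) : cnt s {u | vecT s (readVec s u) = b} = 1 :=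
  cnt_fibre_eq_one s (fun u => vecT s (readVec s u)) (readVec_bijective s) b

/-- Reading an `s × s` matrix off `s²` coins is a bijection. [folklore] -/
theorem readMat_bijective (s : ℕ) :
    Function.Bijective fun r : List.Vector Bool (s * s) => matT s (readMat s r.toList) := by
  classical
  refine (Fintype.bijective_iff_injective_and_card _).2 ⟨fun u v h => ?_, ?_⟩
  · simp only [matT_readMat] at h
    refine List.Vector.eq _ _ (List.ext_getElem (by simp) fun p h₁ h₂ => ?_)
    have hp : p < s * s := by simpa using h₁
    have hs : 0 < s := Nat.pos_of_mul_pos_left (lt_of_le_of_lt (Nat.zero_le _) hp)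
    have hi : p / s < s := Nat.div_lt_of_lt_mul (by rwa [mul_comm] at hp ⊢)
    have hj : p % s < s := Nat.mod_lt _ hs
    have := congrFun (congrFun (congrArg (fun M : Matrix (Fin s) (Fin s) (ZMod 2) => fun i j => M i j) h)
      ⟨p / s, hi⟩) ⟨p % s, hj⟩
    simp only [Matrix.of_apply] at this
    rw [Nat.div_add_mod' p s] at this
    have := bz_injective this
    rwa [List.getD_eq_getElem _ _ h₁, List.getD_eq_getElem _ _ h₂] at this
  · rw [card_vector, Fintype.card_bool, Fintype.card_congr Matrix.of.symm, Fintype.card_fun,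
      Fintype.card_fun, ZMod.card, Fintype.card_fin, ← pow_mul]

/-- Exactly one block of `s²` coins reads as a given matrix. [folklore] -/
theorem cnt_readMat_eq_one (s : ℕ) (A : Matrix (Fin s) (Fin s) (ZMod 2)) :
    cnt (s * s) {u | matT s (readMat s u) = A} = 1 :=
  cnt_fibre_eq_one (s * s) (fun u => matT s (readMat s u)) (readMat_bijective s) A

/-! ### The law of the sampler -/

/-- The number of coin blocks reading as an invertible matrix (`= |GL_s(F₂)|`, `glCount_eq_card`). [folklore] -/
noncomputable def glCount (s : ℕ) : ℕ := cnt (s * s) {u | inv s (readMat s u) = true}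

/-- The number of coin blocks reading as a singular matrix. [folklore] -/
noncomputable def singCount (s : ℕ) : ℕ := cnt (s * s) {u | inv s (readMat s u) = false}

/-- Every block is invertible or singular. [folklore] -/
theorem glCount_add_singCount (s : ℕ) : glCount s + singCount s = 2 ^ (s * s) := by
  rw [glCount, singCount, ← cnt_add_cnt_compl (s * s) {u | inv s (readMat s u) = true}]
  congr 2
  ext u
  simp

/-- `#{u ∈ {0,1}^{t s²} | sel u = A}`: the fibres of the sampler. [folklore] -/
noncomputable def selCount (s t : ℕ) (A : Matrix (Fin s) (Fin s) (ZMod 2)) : ℕ :=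
  cnt (t * (s * s)) {u | matT s (sel s t u) = A}

/-- **The rejection recursion, counted**: for invertible `A`,
`selCount (t+1) A = 2^{t s²} + singCount · selCount t A` (the first candidate is `A`, or it is
singular and the rest selects `A`). [folklore] -/
theorem selCount_succ (s t : ℕ) {A : Matrix (Fin s) (Fin s) (ZMod 2)} (hA : IsUnit A) :
    selCount s (t + 1) A = 2 ^ (t * (s * s)) + singCount s * selCount s t A := by
  have hN : (t + 1) * (s * s) = s * s + t * (s * s) := by ring
  rw [selCount, hN]
  set X₁ : Set (List Bool) := {v | inv s (readMat s v) = true ∧ matT s (readMat s v) = A}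
  set X₂ : Set (List Bool) := {v | inv s (readMat s v) = false}
  set Y : Set (List Bool) := {u | matT s (sel s t u) = A}
  have hsplit : {u : List Bool | matT s (sel s (t + 1) u) = A} =
      {u | u.take (s * s) ∈ X₁} ∪ {u | u.take (s * s) ∈ X₂ ∧ u.drop (s * s) ∈ Y} := by
    ext u
    simp only [Set.mem_setOf_eq, Set.mem_union, sel_succ, X₁, X₂, Y]
    cases inv s (readMat s (u.take (s * s))) <;> simp
  have hdisj : Disjoint {u : List Bool | u.take (s * s) ∈ X₁} {u | u.take (s * s) ∈ X₂ ∧ u.drop (s * s) ∈ Y} := by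
    refine Set.disjoint_left.2 fun u h₁ h₂ => ?_
    simp only [Set.mem_setOf_eq, X₁, X₂] at h₁ h₂
    rw [h₁.1] at h₂
    exact Bool.noConfusion h₂.1
  have hX₁ : cnt (s * s) X₁ = 1 := by
    rw [← cnt_readMat_eq_one s A]
    refine cnt_congr fun v _ => ⟨fun h => h.2, fun h => ⟨(inv_readMat_iff v).2 ?_, h⟩⟩
    rw [show matT s (readMat s v) = A from h]; exact hA
  rw [hsplit, cnt_union_of_disjoint _ hdisj, cnt_take, hX₁, one_mul, cnt_take_and_drop]
  rfl

/-- **The law of the truncated-rejection sampler**: for invertible `A`,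
`selCount t A · glCount + singCount^t ≥ 2^{t s²}`; with `σ = singCount / 2^{s²}` this reads
`Pr[sel = A] ≥ (1 - σ^t) / |GL_s(F₂)|`. [folklore] -/
theorem selCount_bound (s t : ℕ) {A : Matrix (Fin s) (Fin s) (ZMod 2)} (hA : IsUnit A) :
    2 ^ (t * (s * s)) ≤ selCount s t A * glCount s + singCount s ^ t := by
  induction t with
  | zero => simp
  | succ t ih =>
    have h2 : 2 ^ ((t + 1) * (s * s)) = 2 ^ (t * (s * s)) * glCount s + 2 ^ (t * (s * s)) * singCount s := by
      rw [← mul_add, glCount_add_singCount, ← pow_add]; ring_nf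
    rw [h2, selCount_succ s t hA, add_mul, pow_succ]
    have := Nat.mul_le_mul_left (singCount s) ih
    rw [mul_add] at this
    nlinarith [this]

/-! ### The group element read off the coins, and the core map of the kit -/

/-- The input matrix `A`: sampled from the first `t s²` coins. [folklore] -/
def gA (s t : ℕ) (r : List Bool) : List (List (ZMod 2)) := sel s t (r.take (t * (s * s)))

/-- The input shift `b`: the next `s` coins. [folklore] -/
def gb (s t : ℕ) (r : List Bool) : List (ZMod 2) := readVec s ((r.drop (t * (s * s))).take s)

/-- The output matrix `B`: sampled from the next `t m²` coins. [folklore] -/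
def gB (s m t : ℕ) (r : List Bool) : List (List (ZMod 2)) :=
  sel m t (((r.drop (t * (s * s))).drop s).take (t * (m * m)))

/-- The output shift `c`: the next `m` coins. [folklore] -/
def gc (s m t : ℕ) (r : List Bool) : List (ZMod 2) :=
  readVec m ((((r.drop (t * (s * s))).drop s).drop (t * (m * m))).take m)

/-- The number of coins read. [folklore] -/
def need (s m t : ℕ) : ℕ := t * (s * s) + s + t * (m * m) + m

/-- **The normalised transform by the group element read off the coins.** [folklore] -/
def outMapG (s m t : ℕ) (P : List (List (List ℕ))) (r : List Bool) : List (List (List ℕ)) :=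
  outMap s P (gA s t r) (gb s t r) (gB s m t r) (gc s m t r)

/-- **The core map of the orbit kit** on untyped instances `(s, P, k)` and coins `r`: re-randomise `P`
inside its affine orbit by the group element read off `r` and normalise (the number of variables used
is capped by the number of outputs, which is exact on the promise `s ≤ |P|`). [folklore] -/
def core (t : ℕ) (I : ℕ × (List (List (List ℕ)) × ℕ)) (r : List Bool) : ℕ × (List (List (List ℕ)) × ℕ) :=
  (I.1, (outMapG (min I.1 I.2.1.length) I.2.1.length t I.2.1 r, I.2.2))

/-- The typed group element read off the coins: `(A, b, B, c)`. [folklore] -/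
def gT (s m t : ℕ) (r : List Bool) :
    Matrix (Fin s) (Fin s) (ZMod 2) × (Fin s → ZMod 2) × Matrix (Fin m) (Fin m) (ZMod 2) × (Fin m → ZMod 2) :=
  (matT s (gA s t r), vecT s (gb s t r), matT m (gB s m t r), vecT m (gc s m t r))

/-- The matrices read off the coins are invertible. [folklore] -/
theorem gT_isUnit (s m t : ℕ) (r : List Bool) : IsUnit (gT s m t r).1 ∧ IsUnit (gT s m t r).2.2.1 :=
  ⟨isUnit_matT_sel _ _ _, isUnit_matT_sel _ _ _⟩

end OKit

/-- **The law of the truncated-rejection sampler (anchor of the helper file)**: for invertible `A`,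
`#{u | sel u = A} · |GL_s| + #singular^t ≥ 2^{t s²}`. [folklore] -/
theorem orbitKit_selCount_bound (s t : ℕ) {A : Matrix (Fin s) (Fin s) (ZMod 2)} (hA : IsUnit A) :
    2 ^ (t * (s * s)) ≤ OKit.selCount s t A * OKit.glCount s + OKit.singCount s ^ t :=
  OKit.selCount_bound s t hA

end Summit.PneNP.PneNP.Cruxes.PeaWorstToAvg.OrbitPairRsr
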